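import Literature.NumberTheory.DiophantineGeometry.CatalanJacobiSum
import Literature.NumberTheory.DiophantineGeometry.CatalanStickelbergerBridge
import Literature.NumberTheory.DiophantineGeometry.CatalanAssembly
import HarnessLib

/-!
# Mihăilescu's Theorem I (the double Wieferich criterion), proved

**Theorem I** (P. Mihăilescu 2000; *A class number free criterion for Catalan's conjecture*,
J. Number Theory **99** (2003) 225–231; [Schoof2009, Chapter 1, Theorem I, proof in Chapter 10]):
if `p, q` are odd primes and `x, y` non-zero integers with `x ^ p - y ^ q = 1`, then
`p ^ (q-1) ≡ 1 (mod q²)` and `q ^ (p-1) ≡ 1 (mod p²)`.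

The proof is assembled from the tree, following [Schoof2009, Chapters 6, 7, 9, 10]:
Cassels' theorem (`CatalanCassels`, `CatalanCasselsTheorem`), the ideal `(x - ζ_p) = 𝔭 𝔞^q`
(`CatalanObstruction`), Stickelberger's theorem for `ι θ₂` on the degree-one primes dividing `𝔞`
via the Jacobi sum `J(χ, χ)` (`CatalanJacobiSum`), Proposition 10.1 (`CatalanStickelbergerBridge`)
and the `q`-adic Theorem 10.2 (`CatalanWieferich`).

* `Catalan.theoremI` — Theorem I, unconditionally;
* `Catalan.mihailescu_of_theorems_II_III` — `mihailescu` (Catalan's conjecture) now follows from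
  Mihăilescu's Theorems II and III alone (`Catalan.mihailescu_of_mihailescu_theorems` with `hI`
  discharged).

No named fact is introduced.

## References

* R. Schoof, *Catalan's Conjecture*, Universitext, Springer 2009 [Schoof2009], Theorem I
  (p. 4), Chapter 10 (pp. 67–69) — held, `lit read book:schoof2009-catalan-s-conjecture`.
* P. Mihăilescu, *A class number free criterion for Catalan's conjecture*, J. Number Theory **99**
  (2003), 225–231.
* P. Mihăilescu, *Primary cyclotomic units and a proof of Catalan's conjecture*, J. reine angew.
  Math. **572** (2004), 167–195 [Mihailescu2004].
-/

namespace Literature.NumberTheory.DiophantineGeometry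

namespace Catalan

open NumberField

/-- **Mihăilescu's Theorem I — the double Wieferich criterion** [Schoof2009, Theorem I]
(P. Mihăilescu 2000, J. Number Theory **99** (2003)). If `p, q` are odd primes and `x, y` are
non-zero integers with `x ^ p - y ^ q = 1`, then `p ^ (q-1) ≡ 1 (mod q²)` and
`q ^ (p-1) ≡ 1 (mod p²)`. [cite: Schoof2009, Theorem I (Ch. 1 p. 4; proof Ch. 10 p. 68)] -/
theorem theoremI {p q : ℕ} {x y : ℤ} (hp : p.Prime) (hq : q.Prime) (hpo : Odd p) (hqo : Odd q)
    (hx : x ≠ 0) (hy : y ≠ 0) (h : x ^ p - y ^ q = 1) : IsWieferich p q ∧ IsWieferich q p := by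
  haveI := Fact.mk hp
  haveI := Fact.mk hq
  haveI : IsCyclotomicExtension {p} ℚ (CyclotomicField p ℚ) :=
    CyclotomicField.instIsCyclotomicExtensionSingletonNatSetOfCharZero p ℚ
  haveI : IsCyclotomicExtension {q} ℚ (CyclotomicField q ℚ) :=
    CyclotomicField.instIsCyclotomicExtensionSingletonNatSetOfCharZero q ℚ
  haveI : NumberField (CyclotomicField p ℚ) := IsCyclotomicExtension.numberField {p} ℚ _
  haveI : NumberField (CyclotomicField q ℚ) := IsCyclotomicExtension.numberField {q} ℚ _
  exact theoremI_of_isPrincipal (K := CyclotomicField p ℚ) (L := CyclotomicField q ℚ) hpo hqo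
    (fun 𝔩 h1 h2 => isPrincipal_prod_smul_of_absNorm_prime hpo
      (IsCyclotomicExtension.zeta_spec p ℚ (CyclotomicField p ℚ)) 𝔩 h1 h2)
    (fun 𝔩 h1 h2 => isPrincipal_prod_smul_of_absNorm_prime hqo
      (IsCyclotomicExtension.zeta_spec q ℚ (CyclotomicField q ℚ)) 𝔩 h1 h2)
    hx hy h

/-- **Catalan's conjecture from Mihăilescu's Theorems II and III.** With Theorem I proved
(`Catalan.theoremI`), `Literature.NumberTheory.DiophantineGeometry.mihailescu` follows from
Theorem II (`p ≡ 1 (mod q)` or `q ≡ 1 (mod p)`; [Mihailescu2004], [Schoof2009, Ch. 12–14, 16])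
and Theorem III (`p < 4q²`, `q < 4p²`; J. Number Theory **118** (2006), [Schoof2009, Ch. 11])
alone, stated as on [Schoof2009, p. 4]. [cite: Schoof2009, Ch. 1, Main theorem (proof, p. 5)] -/
theorem mihailescu_of_theorems_II_III
    (hII : ∀ {p q : ℕ} {x y : ℤ}, p.Prime → q.Prime → Odd p → Odd q → x ≠ 0 → y ≠ 0 →
      x ^ p - y ^ q = 1 → p ≡ 1 [MOD q] ∨ q ≡ 1 [MOD p])
    (hIII : ∀ {p q : ℕ} {x y : ℤ}, p.Prime → q.Prime → Odd p → Odd q → x ≠ 0 → y ≠ 0 →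
      x ^ p - y ^ q = 1 → p < 4 * q ^ 2 ∧ q < 4 * p ^ 2) :
    mihailescu :=
  mihailescu_of_mihailescu_theorems (fun hp hq hpo hqo hx hy h => theoremI hp hq hpo hqo hx hy h)
    hII hIII

end Catalan

end Literature.NumberTheory.DiophantineGeometry
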